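import Mathlib.MeasureTheory.Integral.IntervalIntegral.FundThmCalculus
import Literature.Analysis.FluidPDE.TorusClassicalH1Balance
import Literature.Analysis.FunctionSpaces.TorusEnstrophyTrilinear
import Literature.Analysis.FunctionSpaces.TorusClassicalNSGluing
import HarnessLib

/-!
# Stub `stub_timeAvgLaplacianBound` of the line `SketchIdeator2` (card `separatrix-flux-pinning`)
# (crux `MarginalStabilityChain.ChainRealisation`, stmt-AnomalousDissipation-14249)

Sorry-free discharge of the registered stub `stub_timeAvgLaplacianBound` (S1) of the lead's
skeleton: the **time-averaged `H²` bound** of a forward classical Navier–Stokes solution on `T³`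
with bounded enstrophy — the first rung of the fixed-`ν` forward-phase construction
(Foias–Manley–Rosa–Temam 2001, Ch. II (A.44)–(A.46), Ch. III §2).

Paper proof.  Restrict the solution to the compact time interval `[t, t+1] ⊆ [0, ∞)`
(`IsClassicalNSSolutionOn.mono`).  There the `H¹` balance
(`IsClassicalNSSolutionOn.hasDerivWithinAt_half_gradNormSq`) reads
`E' = −ν L + D` with `E(s) = ½‖∇u(s)‖₂²`, `L(s) = ‖Δu(s)‖₂²`,
`D(s) = ∫ ⟪(u·∇)u − F, Δu⟫`.  The dissipation form of the trilinear estimate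
(`Torus.abs_integral_inner_convect_laplacian_le_dissipation`) and the pointwise Young inequality
`‖F‖‖Δu‖ ≤ (ν/4)‖Δu‖² + ν⁻¹‖F‖²` give `D ≤ (3ν/4) L + B`, `B = 8K⁴M³/ν³ + ν⁻¹‖F‖₂²`.  Both `L`
and `D` are continuous in time (space integrals of jointly smooth integrands,
`IsSmoothSpaceTimeOn.continuousOn_integral`), so the fundamental theorem of calculus on
`[t, t+1]` gives `ν ∫ₜ^{t+1} L = E(t) − E(t+1) + ∫ₜ^{t+1} D ≤ M/2 + (3ν/4) ∫ₜ^{t+1} L + B`, i.e.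
`∫ₜ^{t+1} L ≤ (4/ν)(M/2 + B)`.
-/

set_option linter.dupNamespace false

noncomputable section

open MeasureTheory Set Filter Topology
open scoped InnerProductSpace
open Literature.Analysis.FunctionSpaces Literature.Analysis.FunctionSpaces.Torus
open Literature.Analysis.FluidPDE

namespace Summit.AnomalousDissipation.AnomalousDissipation.Theorems.ChainRealisation.SeparatrixFluxPinning

/-- Local notation: the torus `T³`. -/
local notation "𝕋³" => UnitAddTorus (Fin 3)
/-- Local notation: velocity values. -/
local notation "E³" => EuclideanSpace ℝ (Fin 3)

/-- Young's inequality in the form used for the force term: `A B ≤ (ν/4) B² + ν⁻¹ A²` for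
`ν > 0` (the difference is `(νB − 2A)² / (4ν) ≥ 0`). -/
private theorem mul_le_quarter_mul_sq_add {ν : ℝ} (hν : 0 < ν) (A B : ℝ) :
    A * B ≤ ν / 4 * B ^ 2 + ν⁻¹ * A ^ 2 := by
  have h : ν / 4 * B ^ 2 + ν⁻¹ * A ^ 2 - A * B = (ν * B - 2 * A) ^ 2 / (4 * ν) := by
    field_simp
    ring
  have h0 : 0 ≤ (ν * B - 2 * A) ^ 2 / (4 * ν) := by positivity
  linarith

/-- The force term of the `H¹` balance: `−∫ ⟪F, Δv⟫ ≤ (ν/4) ‖Δv‖₂² + ν⁻¹ ‖F‖₂²` for smooth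
`F`, `v` on `T³` (pointwise `−⟪F, Δv⟫ ≤ ‖F‖‖Δv‖` and Young, then integrate). -/
private theorem neg_integral_inner_laplacian_le {ν : ℝ} (hν : 0 < ν) {F v : 𝕋³ → E³}
    (hF : IsSmooth F) (hv : IsSmooth v) :
    -∫ x, ⟪F x, laplacian v x⟫_ℝ ≤
      ν / 4 * (∫ x, ‖laplacian v x‖ ^ 2) + ν⁻¹ * ∫ x, ‖F x‖ ^ 2 := by
  have hΔ : IsSmooth (laplacian v) := hv.laplacian
  have i1 : Integrable (fun x => ν / 4 * ‖laplacian v x‖ ^ 2) volume :=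
    hΔ.norm_sq.integrable.const_mul _
  have i2 : Integrable (fun x => ν⁻¹ * ‖F x‖ ^ 2) volume := hF.norm_sq.integrable.const_mul _
  rw [← integral_neg, ← integral_const_mul, ← integral_const_mul, ← integral_add i1 i2]
  refine integral_mono (hF.inner hΔ).integrable.neg (i1.add i2) fun x => ?_
  calc -⟪F x, laplacian v x⟫_ℝ ≤ |⟪F x, laplacian v x⟫_ℝ| := neg_le_abs _
    _ ≤ ‖F x‖ * ‖laplacian v x‖ := abs_real_inner_le_norm _ _
    _ ≤ ν / 4 * ‖laplacian v x‖ ^ 2 + ν⁻¹ * ‖F x‖ ^ 2 := mul_le_quarter_mul_sq_add hν _ _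

/-- The real-analysis core (FMRT 2001, Ch. II (A.46)): if `E' = −ν L + D` on `[t, t+1]` (one-sided
derivative within the interval), `L`, `D` are integrable on `[t, t+1]`, `D ≤ (3ν/4) L + b` there,
`0 ≤ E(t+1)` and `E(t) ≤ m`, then `∫ₜ^{t+1} L ≤ (4/ν)(m + b)` (fundamental theorem of calculus and
monotonicity of the integral). -/
private theorem integral_le_of_balance {t ν b m : ℝ} {E L D : ℝ → ℝ} (hν : 0 < ν)
    (hderiv : ∀ s ∈ Icc t (t + 1), HasDerivWithinAt E (-ν * L s + D s) (Icc t (t + 1)) s)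
    (hLi : IntervalIntegrable L volume t (t + 1)) (hDi : IntervalIntegrable D volume t (t + 1))
    (hD : ∀ s ∈ Icc t (t + 1), D s ≤ 3 * ν / 4 * L s + b) (hE1 : 0 ≤ E (t + 1))
    (hEt : E t ≤ m) : ∫ s in t..t + 1, L s ≤ 4 / ν * (m + b) := by
  have ht1 : t ≤ t + 1 := (lt_add_one t).le
  have hFTC : ∫ s in t..t + 1, (-ν * L s + D s) = E (t + 1) - E t :=
    intervalIntegral.integral_eq_sub_of_hasDerivAt_of_le ht1
      (fun s hs => (hderiv s hs).continuousWithinAt)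
      (fun s hs => (hderiv s (Ioo_subset_Icc_self hs)).hasDerivAt (Icc_mem_nhds hs.1 hs.2))
      ((hLi.const_mul (-ν)).add hDi)
  rw [intervalIntegral.integral_add (hLi.const_mul (-ν)) hDi,
    intervalIntegral.integral_const_mul] at hFTC
  have hDint : ∫ s in t..t + 1, D s ≤ ∫ s in t..t + 1, (3 * ν / 4 * L s + b) :=
    intervalIntegral.integral_mono_on ht1 hDi ((hLi.const_mul _).add intervalIntegrable_const) hD
  rw [intervalIntegral.integral_add (hLi.const_mul _) intervalIntegrable_const,
    intervalIntegral.integral_const_mul, intervalIntegral.integral_const, add_sub_cancel_left,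
    one_smul] at hDint
  rw [div_mul_eq_mul_div, le_div_iff₀ hν]
  linarith

/-- **Stub `stub_timeAvgLaplacianBound` (S1 of the line `SketchIdeator2`): the time-averaged `H²`
bound.**  For a forward classical solution `u` of the Navier–Stokes system on `[0, ∞) × T³` with
viscosity `ν > 0`, steady smooth force `F` and enstrophy bound `‖∇u(t)‖₂² ≤ M` for `t ≥ 0`, the
sliding time averages of `‖Δu‖₂²` are bounded: `∫ₜ^{t+1} ‖Δu(s)‖₂² ds ≤ C` for all `t ≥ 0`, with
`C = (4/ν)(M/2 + 8K⁴M³/ν³ + ν⁻¹‖F‖₂²)`, `K` the constant of the trilinear estimate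
`Torus.abs_integral_inner_convect_laplacian_le_dissipation` (Foias–Manley–Rosa–Temam 2001, Ch. II
(A.44)–(A.46): the `H¹` balance `hasDerivWithinAt_half_gradNormSq` on `[t, t+1]`, the dissipation
form of the trilinear estimate, Young for the force term, and the fundamental theorem of calculus;
the time continuity of `‖Δu‖₂²` and of `∫ ⟪(u·∇)u − F, Δu⟫` is
`IsSmoothSpaceTimeOn.continuousOn_integral`). -/
theorem stub_timeAvgLaplacianBound :
    ∀ (ν M : ℝ) (F : 𝕋³ → E³) (u : ℝ → 𝕋³ → E³) (p : ℝ → 𝕋³ → ℝ),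
      0 < ν → IsSmooth F → IsClassicalNSSolutionOn (Set.Ici 0) ν (fun _ => F) u p →
      (∀ t : ℝ, 0 ≤ t → gradNormSq (u t) ≤ M) →
      ∃ C : ℝ, ∀ t : ℝ, 0 ≤ t → ∫ s in t..t + 1, (∫ x, ‖laplacian (u s) x‖ ^ 2) ≤ C := by
  intro ν M F u p hν hF h hM
  obtain ⟨K, hK⟩ :=
    abs_integral_inner_convect_laplacian_le_dissipation (d := Fin 3) (Fintype.card_fin 3)
  refine ⟨4 / ν * (M / 2 + (8 * (K : ℝ) ^ 4 / ν ^ 3 * M ^ 3 + ν⁻¹ * ∫ x, ‖F x‖ ^ 2)),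
    fun t ht => ?_⟩
  have ht1 : t < t + 1 := lt_add_one t
  have hS : Icc t (t + 1) ⊆ Ici (0 : ℝ) := fun s hs => mem_Ici.2 (ht.trans hs.1)
  have hU : UniqueDiffOn ℝ (Ici (0 : ℝ)) := uniqueDiffOn_Ici 0
  have hSc : Convex ℝ (Ici (0 : ℝ)) := convex_Ici 0
  have hu : Torus.IsSmoothSpaceTimeOn (Ici (0 : ℝ)) u := h.smooth_velocity
  have hΔst : Torus.IsSmoothSpaceTimeOn (Ici (0 : ℝ)) (fun s => laplacian (u s)) :=
    hu.laplacian hU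
  -- time continuity of `L(s) = ‖Δu(s)‖₂²` and `D(s) = ∫ ⟪(u·∇)u − F, Δu⟫`
  have hL2 : Torus.IsSmoothSpaceTimeOn (Ici (0 : ℝ)) (fun s x => ‖laplacian (u s) x‖ ^ 2) :=
    ContDiffOn.norm_sq ℝ hΔst
  have hLc : ContinuousOn (fun s => ∫ x, ‖laplacian (u s) x‖ ^ 2) (Ici (0 : ℝ)) :=
    hL2.continuousOn_integral hSc
  have hDc : ContinuousOn
      (fun s => ∫ x, ⟪convect (u s) (u s) x - F x, laplacian (u s) x⟫_ℝ) (Ici (0 : ℝ)) :=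
    (((hu.convect hu hU).sub (Torus.isSmoothSpaceTimeOn_const hF _)).inner hΔst).continuousOn_integral
      hSc
  -- the `H¹` balance on `[t, t+1]`
  have h' : IsClassicalNSSolutionOn (Icc t (t + 1)) ν (fun _ => F) u p :=
    h.mono hS (uniqueDiffOn_Icc ht1)
  refine integral_le_of_balance (E := fun s => 2⁻¹ * gradNormSq (u s))
    (L := fun s => ∫ x, ‖laplacian (u s) x‖ ^ 2)
    (D := fun s => ∫ x, ⟪convect (u s) (u s) x - F x, laplacian (u s) x⟫_ℝ) hν
    (fun s hs => h'.hasDerivWithinAt_half_gradNormSq ht1 hs)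
    ((hLc.mono hS).intervalIntegrable_of_Icc ht1.le)
    ((hDc.mono hS).intervalIntegrable_of_Icc ht1.le) (fun s hs => ?_)
    (mul_nonneg (by norm_num) (gradNormSq_nonneg _)) ?_
  · -- `D(s) ≤ (3ν/4) L(s) + B`
    have hs0 : s ∈ Ici (0 : ℝ) := hS hs
    have hus : IsSmooth (u s) := hu.isSmooth_slice hs0
    have hΔ : IsSmooth (laplacian (u s)) := hus.laplacian
    have hconv : IsSmooth (convect (u s) (u s)) := hus.convect hus
    have hsplit : (∫ x, ⟪convect (u s) (u s) x - F x, laplacian (u s) x⟫_ℝ) =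
        (∫ x, ⟪convect (u s) (u s) x, laplacian (u s) x⟫_ℝ) - ∫ x, ⟪F x, laplacian (u s) x⟫_ℝ := by
      simp only [inner_sub_left]
      exact integral_sub (hconv.inner hΔ).integrable (hF.inner hΔ).integrable
    have hN := (le_abs_self _).trans (hK ν hν (u s) hus (h.divFree s hs0))
    have hG3 : 8 * (K : ℝ) ^ 4 / ν ^ 3 * gradNormSq (u s) ^ 3 ≤
        8 * (K : ℝ) ^ 4 / ν ^ 3 * M ^ 3 :=
      mul_le_mul_of_nonneg_left (pow_le_pow_left₀ (gradNormSq_nonneg _) (hM s hs0) 3)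
        (by positivity)
    have hP := neg_integral_inner_laplacian_le hν hF hus
    beta_reduce
    rw [hsplit]
    linarith
  · -- `E(t) ≤ M/2`
    have hEt := hM t ht
    linarith

end Summit.AnomalousDissipation.AnomalousDissipation.Theorems.ChainRealisation.SeparatrixFluxPinning

end
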